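import Mathlib
import HarnessLib
import Summits.CriticalPhenomena.PercolationContinuityZ3.Theses.PercTreeValue
import Summits.CriticalPhenomena.PercolationContinuityZ3.Theorems.PercTreeValueTetrahedronDisjointCoexistenceStubShellOfSixWalls
import Summits.CriticalPhenomena.PercolationContinuityZ3.Theorems.PercTreeValueTetrahedronDisjointCoexistenceStubShellDecoupling
import Literature.Probability.Percolation.PlanarDuality
import Literature.Probability.Percolation.RSW
import Literature.Probability.LatticeModels.ThermodynamicLimit
import Literature.Probability.LatticeModels.LatticeGraph

/-!
# `stub_annulusCrossing_le_walls` of line `Sketch` (crux `TetrahedronDisjointCoexistence`,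
# stmt-CriticalPhenomena-7798): the X_B crossing event is bounded by the six wall crossings

Registered stub `stub_annulusCrossing_le_walls` (S10, off-path) of the lead's skeleton
`Cruxes/TetrahedronDisjointCoexistence/Lines/Sketch.lean`, landed DEF-FREE over tree declarations.

For `n ≥ 1` and every `p`, with `P = bondPercolation (zdGraph 3) p`: the X_B annulus-crossing event
"some vertex of `B(n)` is joined inside `B(2n)` to a vertex of the inner vertex boundary of `B(2n)`"
has probability at most `1 - ∏ᵢ (1 - P(Tᵢ)) (1 - P(Bᵢ))`, where `Tᵢ` (resp. `Bᵢ`) is the event that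
the top (resp. bottom) wall of the annulus `B(2n) ∖ B(n)` in direction `i` is crossed by an open
path in its thin direction (the standard reduction "an open path inside `B(2n)` from `B(n)` to
`∂B(2n)` crosses one of the six slabs", last step of `PercAnnulusCrossing.BlockerRSWGlue`).

Proof.
* Pointwise, on lattice configurations `ω ⊆ E(ℤ³)` (`sixWalls_real_mono_of_subset_edgeSet`): an
  open walk inside `B(2n)` from `x ∈ B(n)` to `y ∈ ∂B(2n)` (`exists_walk_of_mem_openConnIn`;
  `y ∉ B(n)` as `n ≥ 1`) has a last exit from `B(n)`: the vertex `u` after it lies in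
  `B(2n) ∖ B(n)`, is adjacent to `B(n)`, and the rest of the walk is an open path of
  `B(2n) ∖ B(n)` from `u` to `y`, which is adjacent to `B(2n)ᶜ` (`annulusWalls_walk`, induction
  along the walk). Hence the X_B event is disjoint from the shell event `Shell(B(n), B(2n))`.
* `P(X_B event) ≤ P(Shellᶜ) = 1 - P(Shell)` (`probReal_compl_eq_one_sub`,
  `shellDecoupling_measurableSet_shell`) and `∏ᵢ (1 - P(Tᵢ)) (1 - P(Bᵢ)) ≤ P(Shell)` is Kesten's
  six walls `stub_shellOfSixWalls` at `lo = -n`, `hi = n`, `lo' = -2n`, `hi' = 2n`.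
-/

noncomputable section

namespace Summit.CriticalPhenomena.PercolationContinuityZ3.Theorems.TetrahedronDisjointCoexistence

open MeasureTheory
open Literature.Probability.Percolation Literature.Probability.LatticeModels

variable {V : Type*}

/-! ### Last exit from the inner set along an open walk -/

/-- **Walk induction** (last exit from `R`). Let `ω` be a configuration, `b ∉ R`, and let `q` be a
walk of `G` from `a` to `b` with all vertices in `R'` and all edges open. Then: if `a ∈ R`, some
`u ∈ R' ∖ R` adjacent to `R` is joined to `b` by an open path of `R' ∖ R`; and if `a ∉ R`, either
`a` itself is joined to `b` by an open path of `R' ∖ R`, or the previous conclusion holds. -/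
theorem annulusWalls_walk (G : SimpleGraph V) {R R' : Set V} {ω : BondConfig V} {b : V}
    (hb : b ∉ R) :
    ∀ {a : V} (q : G.Walk a b), (∀ z ∈ q.support, z ∈ R') → (∀ e ∈ q.edges, e ∈ ω) →
      (a ∈ R → ∃ u ∈ R' \ R, (∃ z ∈ R, G.Adj u z) ∧ ω ∈ openConnIn (R' \ R) u b) ∧
        (a ∉ R → ω ∈ openConnIn (R' \ R) a b ∨
          ∃ u ∈ R' \ R, (∃ z ∈ R, G.Adj u z) ∧ ω ∈ openConnIn (R' \ R) u b) := by
  intro a q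
  induction q with
  | nil =>
    intro hS _
    exact ⟨fun ha => absurd ha hb,
      fun ha => Or.inl (openConnIn_refl ⟨hS _ (SimpleGraph.Walk.start_mem_support _), ha⟩)⟩
  | @cons a a' b hadj q ih =>
    intro hS hE
    have haR' : a ∈ R' := hS a (SimpleGraph.Walk.start_mem_support _)
    have hS' : ∀ z ∈ q.support, z ∈ R' := fun z hz =>
      hS z (by simp only [SimpleGraph.Walk.support_cons, List.mem_cons]; exact Or.inr hz)
    have haa' : s(a, a') ∈ ω :=
      hE _ (by rw [SimpleGraph.Walk.edges_cons]; exact List.mem_cons_self ..)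
    have hE' : ∀ e ∈ q.edges, e ∈ ω := fun e he =>
      hE e (by simp only [SimpleGraph.Walk.edges_cons, List.mem_cons]; exact Or.inr he)
    have ha'R' : a' ∈ R' := hS' a' (SimpleGraph.Walk.start_mem_support q)
    obtain ⟨ih₁, ih₂⟩ := ih hb hS' hE'
    refine ⟨fun haR => ?_, fun haR => ?_⟩
    · -- `a ∈ R`: either the walk re-enters `R` later (induction), or `a'` is the last exit
      by_cases ha'R : a' ∈ R
      · exact ih₁ ha'R
      · rcases ih₂ ha'R with h | h
        · exact ⟨a', ⟨ha'R', ha'R⟩, ⟨a, haR, hadj.symm⟩, h⟩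
        · exact h
    · -- `a ∈ R' ∖ R`
      by_cases ha'R : a' ∈ R
      · exact Or.inr (ih₁ ha'R)
      · rcases ih₂ ha'R with h | h
        · exact Or.inl (PlanarDuality.openConnIn_trans
            (openConnIn_of_adj ⟨haR', haR⟩ ⟨ha'R', ha'R⟩ haa' hadj.ne) h)
        · exact Or.inr h

/-! ### The boxes `B(m)` of `ℤ³` as order intervals -/

/-- `B(m) = [-m, m]³` as a set: the order interval between the constant functions `-m` and `m`. -/
theorem annulusWalls_coe_box (m : ℕ) :
    ((box 3 m : Finset (Site 3)) : Set (Site 3)) =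
      Set.Icc (fun _ : Fin 3 => -(m : ℤ)) (fun _ : Fin 3 => (m : ℤ)) := by
  ext x
  simp only [Finset.mem_coe, mem_box, Set.mem_Icc, Pi.le_def, forall_and]

/-- `B(2m) = [-2m, 2m]³` as a set, with the casts pushed inside. -/
theorem annulusWalls_coe_box_two_mul (m : ℕ) :
    ((box 3 (2 * m) : Finset (Site 3)) : Set (Site 3)) =
      Set.Icc (fun _ : Fin 3 => -(2 * (m : ℤ))) (fun _ : Fin 3 => 2 * (m : ℤ)) := by
  ext x
  simp only [Finset.mem_coe, mem_box, Set.mem_Icc, Pi.le_def, forall_and, Nat.cast_mul,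
    Nat.cast_ofNat]

/-! ### The pointwise heart: an X_B crossing crosses the shell `B(2n) ∖ B(n)` -/

/-- **Pointwise heart.** On a lattice configuration `ω ⊆ E(ℤ³)`, for `n ≥ 1`, an open path inside
`B(2n)` from `x ∈ B(n)` to a vertex `y` of the inner vertex boundary of `B(2n)` contains, after
its last exit from `B(n)`, an open path of the annulus `[-2n, 2n]³ ∖ [-n, n]³` from a vertex `u`
adjacent to `[-n, n]³` to the vertex `y`, which is adjacent to the outside of `[-2n, 2n]³`. -/
theorem annulusWalls_crossing {n : ℕ} (hn : 1 ≤ n) {ω : BondConfig (Site 3)}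
    (hω : ω ⊆ (zdGraph 3).edgeSet) {x y : Site 3} (hx : x ∈ box 3 n)
    (hy : y ∈ innerBoundary (zdGraph 3) (box 3 (2 * n)))
    (hconn : ω ∈ openConnIn (↑(box 3 (2 * n))) x y) :
    ∃ u ∈ Set.Icc (fun _ : Fin 3 => -(2 * (n : ℤ))) (fun _ : Fin 3 => 2 * (n : ℤ)) \
        Set.Icc (fun _ : Fin 3 => -(n : ℤ)) (fun _ : Fin 3 => (n : ℤ)),
      ∃ w ∈ Set.Icc (fun _ : Fin 3 => -(2 * (n : ℤ))) (fun _ : Fin 3 => 2 * (n : ℤ)) \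
          Set.Icc (fun _ : Fin 3 => -(n : ℤ)) (fun _ : Fin 3 => (n : ℤ)),
        (∃ z ∈ Set.Icc (fun _ : Fin 3 => -(n : ℤ)) (fun _ : Fin 3 => (n : ℤ)), (zdGraph 3).Adj u z) ∧
        (∃ z ∉ Set.Icc (fun _ : Fin 3 => -(2 * (n : ℤ))) (fun _ : Fin 3 => 2 * (n : ℤ)),
          (zdGraph 3).Adj w z) ∧
        ω ∈ openConnIn (Set.Icc (fun _ : Fin 3 => -(2 * (n : ℤ))) (fun _ : Fin 3 => 2 * (n : ℤ)) \
          Set.Icc (fun _ : Fin 3 => -(n : ℤ)) (fun _ : Fin 3 => (n : ℤ))) u w := by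
  rw [mem_innerBoundary_iff] at hy
  obtain ⟨_, z', hz', hyz'⟩ := hy
  -- `y ∉ B(n)`: otherwise its neighbour `z'` would lie in `B(n + 1) ⊆ B(2n)`
  have hyn : y ∉ Set.Icc (fun _ : Fin 3 => -(n : ℤ)) (fun _ : Fin 3 => (n : ℤ)) := by
    intro h
    simp only [Set.mem_Icc, Pi.le_def] at h
    refine hz' (mem_box.2 fun i => ?_)
    have h1 := zdGraph_adj_apply_le hyz' i
    have h2 := h.1 i
    have h3 := h.2 i
    omega
  -- an open lattice walk inside `B(2n)` from `x` to `y`, and its last exit from `B(n)`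
  obtain ⟨q, hqS, hqE⟩ := exists_walk_of_mem_openConnIn hω hconn
  rw [annulusWalls_coe_box_two_mul] at hqS
  have hxR : x ∈ Set.Icc (fun _ : Fin 3 => -(n : ℤ)) (fun _ : Fin 3 => (n : ℤ)) := by
    rw [← annulusWalls_coe_box, Finset.mem_coe]
    exact hx
  have hz'R' : z' ∉ Set.Icc (fun _ : Fin 3 => -(2 * (n : ℤ))) (fun _ : Fin 3 => 2 * (n : ℤ)) := by
    rw [← annulusWalls_coe_box_two_mul, Finset.mem_coe]
    exact hz'
  obtain ⟨u, hu, huz, hconn'⟩ := (annulusWalls_walk (zdGraph 3) hyn q hqS hqE).1 hxR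
  exact ⟨u, hu, y, ⟨hqS y q.end_mem_support, hyn⟩, huz, ⟨z', hz'R', hyz'⟩, hconn'⟩

/-! ### The stub -/

/-- **S10 — the six walls of `B(2n) ∖ B(n)` bound the X_B crossing event.** For `n ≥ 1` and every
`p`, with `P = bondPercolation (zdGraph 3) p`: the X_B annulus-crossing event (some vertex of `B(n)`
joined inside `B(2n)` to the inner vertex boundary of `B(2n)`) forces an open crossing of the
annulus `B(2n) ∖ B(n)` from a neighbour of `B(n)` to a vertex adjacent to `B(2n)ᶜ` (last exit from
`B(n)`, `annulusWalls_crossing`), i.e. it is disjoint from `Shell(B(n), B(2n))`; hence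
`P(X_B event) ≤ 1 - P(Shell) ≤ 1 - ∏_{6 walls} (1 - P(wall crossed in its thin direction))` by
Kesten's six walls (`stub_shellOfSixWalls` at `lo = -n`, `hi = n`, `lo' = -2n`, `hi' = 2n`), the
walls being the slabs `[-2n, 2n]² × [n + 1, 2n]` etc. (thickness `n`, lateral `4n + 1`). -/
theorem stub_annulusCrossing_le_walls (p : unitInterval) (n : ℕ) (hn : 1 ≤ n) :
    (bondPercolation (zdGraph 3) p).real
        {ω | ∃ x ∈ box 3 n, ∃ y ∈ innerBoundary (zdGraph 3) (box 3 (2 * n)),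
          ω ∈ openConnIn ↑(box 3 (2 * n)) x y} ≤
      1 - ∏ i : Fin 3,
        ((1 - (bondPercolation (zdGraph 3) p).real
            {ω | ∃ x y : Site 3, x ∈ Set.Icc (fun _ : Fin 3 => -(2 * (n : ℤ))) (fun _ : Fin 3 => 2 * (n : ℤ)) ∧
              y ∈ Set.Icc (fun _ : Fin 3 => -(2 * (n : ℤ))) (fun _ : Fin 3 => 2 * (n : ℤ)) ∧
              x i = (n : ℤ) + 1 ∧ y i = 2 * (n : ℤ) ∧
              ω ∈ openConnIn (Set.Icc (fun _ : Fin 3 => -(2 * (n : ℤ))) (fun _ : Fin 3 => 2 * (n : ℤ)) ∩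
                {z | (n : ℤ) + 1 ≤ z i}) x y}) *
          (1 - (bondPercolation (zdGraph 3) p).real
            {ω | ∃ x y : Site 3, x ∈ Set.Icc (fun _ : Fin 3 => -(2 * (n : ℤ))) (fun _ : Fin 3 => 2 * (n : ℤ)) ∧
              y ∈ Set.Icc (fun _ : Fin 3 => -(2 * (n : ℤ))) (fun _ : Fin 3 => 2 * (n : ℤ)) ∧
              x i = -(n : ℤ) - 1 ∧ y i = -(2 * (n : ℤ)) ∧
              ω ∈ openConnIn (Set.Icc (fun _ : Fin 3 => -(2 * (n : ℤ))) (fun _ : Fin 3 => 2 * (n : ℤ)) ∩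
                {z | z i ≤ -(n : ℤ) - 1}) x y})) := by
  have hlo : ∀ _i : Fin 3, -(2 * (n : ℤ)) < -(n : ℤ) := fun _ => by omega
  have hhi : ∀ _i : Fin 3, (n : ℤ) < 2 * (n : ℤ) := fun _ => by omega
  -- Kesten's six walls: `∏ (1 - P(Tᵢ)) (1 - P(Bᵢ)) ≤ P(Shell(B(n), B(2n)))`
  have h7 := stub_shellOfSixWalls p (fun _ => -(n : ℤ)) (fun _ => (n : ℤ))
    (fun _ => -(2 * (n : ℤ))) (fun _ => 2 * (n : ℤ)) hlo hhi
  refine le_trans ?_ (sub_le_sub_left h7 1)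
  -- `P(X_B event) ≤ P(Shellᶜ) = 1 - P(Shell)`
  rw [← probReal_compl_eq_one_sub (shellDecoupling_measurableSet_shell (zdGraph 3)
    (Set.Icc (fun _ : Fin 3 => -(n : ℤ)) fun _ : Fin 3 => (n : ℤ))
    (Set.Icc (fun _ : Fin 3 => -(2 * (n : ℤ))) fun _ : Fin 3 => 2 * (n : ℤ)))]
  refine sixWalls_real_mono_of_subset_edgeSet (zdGraph 3) p fun ω hω hmem => ?_
  obtain ⟨x, hx, y, hy, hconn⟩ := hmem
  obtain ⟨u, hu, w, hw, huz, hwz, hconn'⟩ := annulusWalls_crossing hn hω hx hy hconn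
  intro hshell
  exact hshell u hu w hw huz hwz hconn'

end Summit.CriticalPhenomena.PercolationContinuityZ3.Theorems.TetrahedronDisjointCoexistence

end
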